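import Summits.Ventures.QEC.Census.BB.BB288.CoverLevel2Defs
import HarnessLib

set_option Elab.async false
set_option maxRecDepth 100000
set_option exponentiation.threshold 512

/-!
# `[[288,12,18]]` cover certificate — LEVEL 2 straggler lists (DATA for `CoverLevel2M1e`): per lane family, the codewords of
weight `≤ 16` it meets, ascending (computed by `work/cover288/gen_level2_v2.py`; every one is a `FOUND₂` word, which
`CoverLevel2M1e` re-checks by `Plane.subWalk`).  Statement-only data module; tier KERNEL.
-/

namespace Summit.Ventures.QEC.Census.BB288Cover

open Summit.Ventures.QEC.Census Literature.InformationTheory.QuantumCodes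

/-- Stragglers (codewords of weight `≤ 16`) of family `m1p1345` (12951 lanes), ascending. -/
def m1p1345_allow : List ℕ := [
    4629715436978579584, 5044045494456682503, 9241471824179570816 ]

/-- Stragglers (codewords of weight `≤ 16`) of family `m1p0245` (12951 lanes), ascending. -/
def m1p0245_allow : List ℕ := [
    4827872347069351973, 2366017869181333028869 ]

/-- Stragglers (codewords of weight `≤ 16`) of family `m1p0135` (12951 lanes), ascending. -/
def m1p0135_allow : List ℕ := [
    685324376791276584960 ]

/-- Stragglers (codewords of weight `≤ 16`) of family `m1p01345` (2325 lanes), ascending. -/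
def m1p01345_allow : List ℕ := [
    5260219449297864736, 42153813115473496320, 226622274199293528096, 2366450216283561541632 ]

/-- Stragglers (codewords of weight `≤ 16`) of family `m1p01234` (2325 lanes), ascending. -/
def m1p01234_allow : List ℕ := [
    2666277169688216608 ]

/-- Stragglers (codewords of weight `≤ 16`) of family `m1p01245` (2325 lanes), ascending. -/
def m1p01245_allow : List ℕ := [
    2365927797317508792580 ]

/-- Stragglers (codewords of weight `≤ 16`) of family `m1p12345` (2325 lanes), ascending. -/
def m1p12345_allow : List ℕ := [
    5332277262446233601 ]

/-- Stragglers (codewords of weight `≤ 16`) of family `m1p01235` (2325 lanes), ascending. -/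
def m1p01235_allow : List ℕ := []

/-- Stragglers (codewords of weight `≤ 16`) of family `m1p02345` (2325 lanes), ascending. -/
def m1p02345_allow : List ℕ := []

/-- Stragglers (codewords of weight `≤ 16`) of family `m1p012345` (301 lanes), ascending. -/
def m1p012345_allow : List ℕ := []


end Summit.Ventures.QEC.Census.BB288Cover
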